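import Mathlib.Analysis.SpecificLimits.Normed
import Mathlib.Analysis.Real.Sqrt
import Mathlib.Algebra.Polynomial.Eval.Degree
import Mathlib.Tactic
import Literature.Computability.QuantumComplexity.TreeFrameTensorGap
import HarnessLib

/-!
# The X-state gadget: separable directions on `2m` qubits whose LOCC-tree frames weigh `≥ (43/40)^m`

Concrete instance of `exists_separable_treeHeavy` (file `TreeFrameTensorGap`) and the resulting
SUPERPOLYNOMIAL growth of the SEP-vs-tree-frame dilation constant `κₙ` of route
`QuantumAdvantage/SeparableFrames` — the content of the refutation of its crux
`FrameDilationPolynomial` (`κₙ ≤ poly(n)` is false: `κ_{2m} ≥ (43/40)^m`).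

Gadget (basis order `|s t⟩`, `false = |0⟩`; certified earlier at `n = 2` in
`Summits/QuantumAdvantage/QuantumAdvantage/Theorems/SeparableFramesTwoQubitFrameExactnessRefutation`):
* direction `A = [[-5/8,0,0,-3/4],[0,1/4,0,0],[0,0,1/4,0],[-3/4,0,0,1/2]]` with explicit
  product-vector decompositions of `1 + A` and `1 - A` (`XStateGadget.one_add_kernel_decomp`,
  `XStateGadget.one_sub_kernel_decomp`);
* functional `W = 1 - |χ⟩⟨χ|`, `χ = 2|00⟩ + |11⟩`, swap-symmetric, `tr(W A) = 43/8`
  (`XStateGadget.trace_value`);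
* potential data `F(α) = 4|α₀|² + |α₁|²`, `Q = √5`: `∑_b F(u_b) = 5` on orthonormal bases
  (column normalisation) and `∑_b |⟨u_b|W_α|u_b⟩| = ∑_b |1 - |2α₀u_{b0} + α₁u_{b1}|²| ≤ F(α)`
  (Parseval `∑_b |2α₀u_{b0} + α₁u_{b1}|² = F(α) ≥ 1`), i.e. the tree value of `W` is `≤ 5`.
Consequences: `exists_separable_treeHeavy_pow` — on `2m` qubits some `T` with `1 ± T` fully
separable has tree-frame weight `∑|cₖ| ≥ (43/40)^m` in EVERY decomposition into
`treeDiagonalContractions`; `natPoly_eval_two_mul_lt_pow` — polynomials lose to `(43/40)^m`;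
`frameDilation_superpolynomial` — for every `p : Polynomial ℕ` there are `n` and `T` with
`1 ± T ∈ fullySeparableCone n` all of whose tree-frame decompositions weigh `> p(n)`.
Theorem-only file; every statement is elementary (tagged folklore).
-/

namespace Literature.Computability.QuantumComplexity

open Literature.Computability.Cryptography (QReg)
open Filter Topology

namespace XStateGadget

/-- The functional kernel `W = 1 - |χ⟩⟨χ|`, `χ = 2|00⟩ + |11⟩`, is symmetric under swapping the two
qubits. [folklore] -/
theorem kernel_swap : ∀ s t s' t' : Bool,
    (fun s t s' t' : Bool => (if s = s' then (1 : ℂ) else 0) * (if t = t' then 1 else 0) -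
      (cond s (cond t (1 : ℂ) 0) (cond t 0 2)) * (cond s' (cond t' (1 : ℂ) 0) (cond t' 0 2)))
        s t s' t' =
    (fun s t s' t' : Bool => (if s = s' then (1 : ℂ) else 0) * (if t = t' then 1 else 0) -
      (cond s (cond t (1 : ℂ) 0) (cond t 0 2)) * (cond s' (cond t' (1 : ℂ) 0) (cond t' 0 2)))
        t s t' s' := by
  intro s t s' t'
  cases s <;> cases t <;> cases s' <;> cases t' <;> simp

/-- `tr(W A) = 43/8` for the X-state direction `A` and `W = 1 - |χ⟩⟨χ|`. [folklore] -/
theorem trace_value :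
    ∑ s, ∑ t, ∑ s', ∑ t',
      (fun s t s' t' : Bool => (if s = s' then (1 : ℂ) else 0) * (if t = t' then 1 else 0) -
        (cond s (cond t (1 : ℂ) 0) (cond t 0 2)) * (cond s' (cond t' (1 : ℂ) 0) (cond t' 0 2)))
          s t s' t' *
      (fun s t s' t' : Bool => cond (s == s' && t == t')
        (cond s (cond t (1 / 2 : ℂ) (1 / 4)) (cond t (1 / 4 : ℂ) (-5 / 8)))
        (cond (s == t && s' == t') (-3 / 4 : ℂ) 0)) s' t' s t = ((43 / 8 : ℝ) : ℂ) := by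
  simp only [Fintype.sum_bool]
  norm_num [Complex.ext_iff]

/-- Explicit product-vector decomposition of `1 + A`:
`1 + A = (1/384) Σ_k |Φ'_k⟩⟨Φ'_k| + 13/32 |01⟩⟨01| + 7/12 |10⟩⟨10|`, `Φ'_k = (3, 4iᵏ) ⊗ (2, -3i⁻ᵏ)`.
[folklore] -/
theorem one_add_kernel_decomp : ∃ (K : ℕ) (w : Fin K → ℝ) (f g : Fin K → Bool → ℂ),
    (∀ i, 0 ≤ w i) ∧ ∀ s t s' t',
      (if s = s' then (1 : ℂ) else 0) * (if t = t' then 1 else 0) +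
        (fun s t s' t' : Bool => cond (s == s' && t == t')
          (cond s (cond t (1 / 2 : ℂ) (1 / 4)) (cond t (1 / 4 : ℂ) (-5 / 8)))
          (cond (s == t && s' == t') (-3 / 4 : ℂ) 0)) s t s' t' =
      ∑ i, (w i : ℂ) * (f i s * star (f i s')) * (g i t * star (g i t')) := by
  refine ⟨6, ![1/384, 1/384, 1/384, 1/384, 13/32, 7/12],
    ![(fun t : Bool => cond t (4 : ℂ) 3), (fun t : Bool => cond t (4 * Complex.I) 3),
      (fun t : Bool => cond t (-4 : ℂ) 3), (fun t : Bool => cond t (-4 * Complex.I) 3),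
      (fun t : Bool => cond t (0 : ℂ) 1), (fun t : Bool => cond t (1 : ℂ) 0)],
    ![(fun t : Bool => cond t (-3 : ℂ) 2), (fun t : Bool => cond t (3 * Complex.I) 2),
      (fun t : Bool => cond t (3 : ℂ) 2), (fun t : Bool => cond t (-3 * Complex.I) 2),
      (fun t : Bool => cond t (1 : ℂ) 0), (fun t : Bool => cond t (0 : ℂ) 1)], ?_, ?_⟩
  · intro i
    fin_cases i <;> norm_num
  · intro s t s' t'
    simp only [Fin.sum_univ_succ, Fin.sum_univ_zero, Matrix.cons_val_zero, Matrix.cons_val_succ,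
      add_zero]
    cases s <;> cases t <;> cases s' <;> cases t' <;> simp [Complex.ext_iff] <;> norm_num

/-- Explicit product-vector decomposition of `1 - A`:
`1 - A = (1/768) Σ_k |Φ_k⟩⟨Φ_k| + 7/24 |00⟩⟨00| + 5/64 |11⟩⟨11|`, `Φ_k = (4, 3iᵏ) ⊗ (4, 3i⁻ᵏ)`.
[folklore] -/
theorem one_sub_kernel_decomp : ∃ (K : ℕ) (w : Fin K → ℝ) (f g : Fin K → Bool → ℂ),
    (∀ i, 0 ≤ w i) ∧ ∀ s t s' t',
      (if s = s' then (1 : ℂ) else 0) * (if t = t' then 1 else 0) -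
        (fun s t s' t' : Bool => cond (s == s' && t == t')
          (cond s (cond t (1 / 2 : ℂ) (1 / 4)) (cond t (1 / 4 : ℂ) (-5 / 8)))
          (cond (s == t && s' == t') (-3 / 4 : ℂ) 0)) s t s' t' =
      ∑ i, (w i : ℂ) * (f i s * star (f i s')) * (g i t * star (g i t')) := by
  refine ⟨6, ![1/768, 1/768, 1/768, 1/768, 7/24, 5/64],
    ![(fun t : Bool => cond t (3 : ℂ) 4), (fun t : Bool => cond t (3 * Complex.I) 4),
      (fun t : Bool => cond t (-3 : ℂ) 4), (fun t : Bool => cond t (-3 * Complex.I) 4),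
      (fun t : Bool => cond t (0 : ℂ) 1), (fun t : Bool => cond t (1 : ℂ) 0)],
    ![(fun t : Bool => cond t (3 : ℂ) 4), (fun t : Bool => cond t (-3 * Complex.I) 4),
      (fun t : Bool => cond t (-3 : ℂ) 4), (fun t : Bool => cond t (3 * Complex.I) 4),
      (fun t : Bool => cond t (0 : ℂ) 1), (fun t : Bool => cond t (1 : ℂ) 0)], ?_, ?_⟩
  · intro i
    fin_cases i <;> norm_num
  · intro s t s' t'
    simp only [Fin.sum_univ_succ, Fin.sum_univ_zero, Matrix.cons_val_zero, Matrix.cons_val_succ,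
      add_zero]
    cases s <;> cases t <;> cases s' <;> cases t' <;> simp [Complex.ext_iff] <;> norm_num

/-- Column normalisation: for an orthonormal qubit basis `u`, `∑_b (4|u_{b0}|² + |u_{b1}|²) = 5`,
stated as `≤ √5 · √5`. [folklore] -/
theorem potential_onb (u : Bool → Bool → ℂ) (hu : IsQubitONB u) :
    ∑ b, (4 * ‖u b false‖ ^ 2 + ‖u b true‖ ^ 2) ≤ Real.sqrt 5 * Real.sqrt 5 := by
  have mss : ∀ z : ℂ, z * star z = ((‖z‖ : ℂ)) ^ 2 := fun z => Complex.mul_conj' z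
  have col : ∀ t, ‖u true t‖ ^ 2 + ‖u false t‖ ^ 2 = 1 := fun t => by
    have h := hu.sum_mul_star t t
    rw [if_pos rfl, Fintype.sum_bool, mss, mss] at h
    exact_mod_cast h
  rw [Real.mul_self_sqrt (by norm_num : (0 : ℝ) ≤ 5), Fintype.sum_bool]
  linarith [col false, col true]

/-- `|1 - x| + |1 - y| ≤ x + y` for `x, y ≥ 0` with `x + y ≥ 1`. [folklore] -/
theorem abs_one_sub_add_abs_one_sub_le {x y : ℝ} (hx : 0 ≤ x) (hy : 0 ≤ y) (h : 1 ≤ x + y) :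
    |1 - x| + |1 - y| ≤ x + y := by
  rcases le_or_gt x 1 with h1 | h1 <;> rcases le_or_gt y 1 with h2 | h2
  · rw [abs_of_nonneg (by linarith), abs_of_nonneg (by linarith)]; linarith
  · rw [abs_of_nonneg (by linarith), abs_of_neg (by linarith)]; linarith
  · rw [abs_of_neg (by linarith), abs_of_nonneg (by linarith)]; linarith
  · rw [abs_of_neg (by linarith), abs_of_neg (by linarith)]; linarith

/-- The partner step of the potential argument for `W`: for a unit vector `α` (the outcome on the
first qubit of the pair) and an orthonormal basis `u` of the second qubit,
`∑_b |⟨u_b| W_α |u_b⟩| = ∑_b |1 - |2α₀u_{b0} + α₁u_{b1}|²| ≤ 4|α₀|² + |α₁|²`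
(Parseval in `u`: `∑_b |2α₀u_{b0} + α₁u_{b1}|² = 4|α₀|² + |α₁|² ≥ 1`). [folklore] -/
theorem contracted_value_le (α : Bool → ℂ) (u : Bool → Bool → ℂ)
    (hα : ∑ t, star (α t) * α t = 1) (hu : IsQubitONB u) :
    ∑ b, ‖∑ t, ∑ t', star (u b t) * (∑ s, ∑ s', star (α s) *
      (fun s t s' t' : Bool => (if s = s' then (1 : ℂ) else 0) * (if t = t' then 1 else 0) -
        (cond s (cond t (1 : ℂ) 0) (cond t 0 2)) * (cond s' (cond t' (1 : ℂ) 0) (cond t' 0 2)))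
          s t s' t' * α s') * u b t'‖ ≤ 4 * ‖α false‖ ^ 2 + ‖α true‖ ^ 2 := by
  have hα' : star (α true) * α true + star (α false) * α false = 1 := by
    rwa [Fintype.sum_bool] at hα
  have hub : ∀ b, star (u b true) * u b true + star (u b false) * u b false = 1 := fun b => by
    have := hu b b
    rwa [if_pos rfl, Fintype.sum_bool] at this
  -- the contracted quadratic form in closed form
  have hq : ∀ b, ∑ t, ∑ t', star (u b t) * (∑ s, ∑ s', star (α s) *
      (fun s t s' t' : Bool => (if s = s' then (1 : ℂ) else 0) * (if t = t' then 1 else 0) -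
        (cond s (cond t (1 : ℂ) 0) (cond t 0 2)) * (cond s' (cond t' (1 : ℂ) 0) (cond t' 0 2)))
          s t s' t' * α s') * u b t' =
      1 - star (2 * α false * u b false + α true * u b true) *
        (2 * α false * u b false + α true * u b true) := by
    intro b
    simp only [Fintype.sum_bool, cond_true, cond_false, Bool.true_eq_false, Bool.false_eq_true,
      if_true, if_false, star_add, star_mul', star_ofNat]
    linear_combination (star (u b true) * u b true + star (u b false) * u b false) * hα' + hub b
  have sms : ∀ z : ℂ, star z * z = ((‖z‖ : ℂ)) ^ 2 := fun z => Complex.conj_mul' z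
  have hnorm : ∀ b, ‖(1 : ℂ) - star (2 * α false * u b false + α true * u b true) *
      (2 * α false * u b false + α true * u b true)‖ =
      |1 - ‖2 * α false * u b false + α true * u b true‖ ^ 2| := by
    intro b
    rw [sms, ← Complex.ofReal_pow, ← Complex.ofReal_one, ← Complex.ofReal_sub, Complex.norm_real,
      Real.norm_eq_abs]
  -- Parseval in the basis `u`
  have cff := hu.sum_mul_star false false
  have ctt := hu.sum_mul_star true true
  have cft := hu.sum_mul_star false true
  have ctf := hu.sum_mul_star true false
  rw [if_pos rfl, Fintype.sum_bool] at cff ctt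
  rw [if_neg (by decide), Fintype.sum_bool] at cft ctf
  have hparC : star (2 * α false * u true false + α true * u true true) *
        (2 * α false * u true false + α true * u true true) +
      star (2 * α false * u false false + α true * u false true) *
        (2 * α false * u false false + α true * u false true) =
      4 * (star (α false) * α false) + star (α true) * α true := by
    simp only [star_add, star_mul', star_ofNat]
    linear_combination (4 * star (α false) * α false) * cff + (star (α true) * α true) * ctt +
      (2 * star (α false) * α true) * ctf + (2 * star (α true) * α false) * cft
  have hpar : ‖2 * α false * u true false + α true * u true true‖ ^ 2 +
      ‖2 * α false * u false false + α true * u false true‖ ^ 2 =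
      4 * ‖α false‖ ^ 2 + ‖α true‖ ^ 2 := by
    rw [sms, sms, sms, sms] at hparC
    exact_mod_cast hparC
  have hαr : ‖α true‖ ^ 2 + ‖α false‖ ^ 2 = 1 := by
    have h := hα'
    rw [sms, sms] at h
    exact_mod_cast h
  rw [Fintype.sum_bool, hq, hq, hnorm, hnorm]
  have hsum : 1 ≤ ‖2 * α false * u true false + α true * u true true‖ ^ 2 +
      ‖2 * α false * u false false + α true * u false true‖ ^ 2 := by
    rw [hpar]; nlinarith [sq_nonneg ‖α false‖]
  calc |1 - ‖2 * α false * u true false + α true * u true true‖ ^ 2| +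
        |1 - ‖2 * α false * u false false + α true * u false true‖ ^ 2|
      ≤ ‖2 * α false * u true false + α true * u true true‖ ^ 2 +
          ‖2 * α false * u false false + α true * u false true‖ ^ 2 :=
        abs_one_sub_add_abs_one_sub_le (sq_nonneg _) (sq_nonneg _) hsum
    _ = 4 * ‖α false‖ ^ 2 + ‖α true‖ ^ 2 := hpar

end XStateGadget

/-- **Separable directions with exponentially heavy LOCC-tree frames.** For every `m` there is
an operator `T` on `2m` qubits (the tensor power `A^{⊗m}` of the X-state direction) such that
`1 + T` and `1 - T` are fully separable (two-sided separable radius `≥ 1`) while every real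
decomposition `T = ∑ₖ cₖ Dₖ` into LOCC-tree diagonal contractions has weight
`∑ₖ |cₖ| ≥ (43/40)^m`: the dilation constant between the symmetric SEP body and the tree-frame
body satisfies `κ_{2m} ≥ 1.075^m`. [folklore] -/
theorem exists_separable_treeHeavy_pow (m : ℕ) :
    ∃ T : Matrix (QReg (2 * m)) (QReg (2 * m)) ℂ,
      1 + T ∈ fullySeparableCone (2 * m) ∧ 1 - T ∈ fullySeparableCone (2 * m) ∧
      ∀ (K : ℕ) (c : Fin K → ℝ) (D : Fin K → Matrix (QReg (2 * m)) (QReg (2 * m)) ℂ),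
        (∀ k, D k ∈ treeDiagonalContractions (2 * m)) → T = ∑ k, ((c k : ℂ)) • D k →
        (43 / 40 : ℝ) ^ m ≤ ∑ k, |c k| := by
  obtain ⟨T, hp, hm, hT⟩ := exists_separable_treeHeavy
    (fun s t s' t' : Bool => (if s = s' then (1 : ℂ) else 0) * (if t = t' then 1 else 0) -
      (cond s (cond t (1 : ℂ) 0) (cond t 0 2)) * (cond s' (cond t' (1 : ℂ) 0) (cond t' 0 2)))
    (fun s t s' t' : Bool => cond (s == s' && t == t')
      (cond s (cond t (1 / 2 : ℂ) (1 / 4)) (cond t (1 / 4 : ℂ) (-5 / 8)))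
      (cond (s == t && s' == t') (-3 / 4 : ℂ) 0))
    XStateGadget.kernel_swap (fun α : Bool → ℂ => 4 * ‖α false‖ ^ 2 + ‖α true‖ ^ 2)
    (Real.sqrt 5) (43 / 8) (Real.sqrt_nonneg 5) XStateGadget.potential_onb
    XStateGadget.contracted_value_le XStateGadget.one_add_kernel_decomp
    XStateGadget.one_sub_kernel_decomp XStateGadget.trace_value m
  refine ⟨T, hp, hm, fun K c D hD hTD => ?_⟩
  have h := hT K c D hD hTD
  rw [Real.mul_self_sqrt (by norm_num : (0 : ℝ) ≤ 5)] at h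
  have h5 : (0 : ℝ) < 5 ^ m := by positivity
  rw [show (43 / 40 : ℝ) ^ m = (43 / 8) ^ m / 5 ^ m by rw [← div_pow]; norm_num,
    div_le_iff₀ h5]
  linarith

/-- Polynomials lose to exponentials along the even numbers: for `p : Polynomial ℕ` and `r > 1`
there is `m` with `p(2m) < r ^ m`. [folklore] -/
theorem natPoly_eval_two_mul_lt_pow (p : Polynomial ℕ) {r : ℝ} (hr : 1 < r) :
    ∃ m : ℕ, ((p.eval (2 * m) : ℕ) : ℝ) < r ^ m := by
  -- `p(n) ≤ p(1) · n^d` for `n ≥ 1`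
  have hbound : ∀ n : ℕ, 1 ≤ n → p.eval n ≤ p.eval 1 * n ^ p.natDegree := by
    intro n hn
    rw [Polynomial.eval_eq_sum_range, Polynomial.eval_eq_sum_range, Finset.sum_mul]
    refine Finset.sum_le_sum fun i hi => ?_
    rw [one_pow, mul_one]
    exact Nat.mul_le_mul_left _
      (Nat.pow_le_pow_right hn (Nat.lt_succ_iff.mp (Finset.mem_range.mp hi)))
  set d := p.natDegree with hd
  set B : ℝ := (p.eval 1 : ℕ) * 2 ^ d with hB
  have hB0 : 0 ≤ B := by positivity
  have ht := tendsto_pow_const_div_const_pow_of_one_lt d hr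
  have hε : (0 : ℝ) < 1 / (B + 1) := by positivity
  obtain ⟨N, hN⟩ := Filter.eventually_atTop.1 (ht.eventually (gt_mem_nhds hε))
  refine ⟨max N 1, ?_⟩
  have hm1 : 1 ≤ max N 1 := le_max_right _ _
  have hrm : 0 < r ^ max N 1 := pow_pos (by linarith) _
  have h1 := hN (max N 1) (le_max_left _ _)
  rw [div_lt_iff₀ hrm] at h1
  -- h1 : (max N 1 : ℝ) ^ d < 1 / (B + 1) * r ^ max N 1
  have h2 : ((p.eval (2 * max N 1) : ℕ) : ℝ) ≤ B * ((max N 1 : ℕ) : ℝ) ^ d := by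
    have h3 : ((p.eval (2 * max N 1) : ℕ) : ℝ) ≤ ((p.eval 1 * (2 * max N 1) ^ d : ℕ) : ℝ) := by
      exact_mod_cast hbound (2 * max N 1) (by omega)
    calc ((p.eval (2 * max N 1) : ℕ) : ℝ) ≤ ((p.eval 1 * (2 * max N 1) ^ d : ℕ) : ℝ) := h3
      _ = B * ((max N 1 : ℕ) : ℝ) ^ d := by rw [hB]; push_cast; ring
  calc ((p.eval (2 * max N 1) : ℕ) : ℝ) ≤ B * ((max N 1 : ℕ) : ℝ) ^ d := h2
    _ ≤ B * (1 / (B + 1) * r ^ max N 1) := mul_le_mul_of_nonneg_left h1.le hB0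
    _ = B / (B + 1) * r ^ max N 1 := by ring
    _ < r ^ max N 1 := by
        refine mul_lt_of_lt_one_left hrm ?_
        rw [div_lt_one (by positivity)]
        linarith

/-- **The SEP-vs-tree-frame dilation is superpolynomial** (refutes `κₙ ≤ poly(n)`): for every
`p : Polynomial ℕ` there are `n` and an operator `T` on `n` qubits with `1 + T` and `1 - T` in the
fully separable cone such that every real decomposition `T = ∑ₖ cₖ Dₖ` into LOCC-tree diagonal
contractions (`treeDiagonalContractions n`) has `∑ₖ |cₖ| > p(n)`. [folklore] -/
theorem frameDilation_superpolynomial (p : Polynomial ℕ) :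
    ∃ (n : ℕ) (T : Matrix (QReg n) (QReg n) ℂ),
      1 + T ∈ fullySeparableCone n ∧ 1 - T ∈ fullySeparableCone n ∧
      ∀ (K : ℕ) (c : Fin K → ℝ) (D : Fin K → Matrix (QReg n) (QReg n) ℂ),
        (∀ k, D k ∈ treeDiagonalContractions n) → T = ∑ k, ((c k : ℂ)) • D k →
        ((p.eval n : ℕ) : ℝ) < ∑ k, |c k| := by
  obtain ⟨m, hm⟩ := natPoly_eval_two_mul_lt_pow p (by norm_num : (1 : ℝ) < 43 / 40)
  obtain ⟨T, hp, hmi, hT⟩ := exists_separable_treeHeavy_pow m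
  exact ⟨2 * m, T, hp, hmi, fun K c D hD hTD => hm.trans_le (hT K c D hD hTD)⟩

end Literature.Computability.QuantumComplexity
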